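import Summits.ResolutionOfSingularities.ResolutionOfSingularities.Theorems.FrobeniusLadderFInjectiveMacaulayficationMonomialChartPresentationRange
import HarnessLib

/-!
# CI chart presentation (C1ᶜⁱ), part 1: the chart map `Ψ_F` and its range, for an ARBITRARY ideal `F`
(crux `FInjectiveMacaulayfication`, CI-CN engine kernel, CRUX-PLAN w45a v8 R9.1 piece C1ᶜⁱ; seat res-L1-w45a-stub-1)

[OURS · L1 W4.5a] Support file for crux stmt-ResolutionOfSingularities-15315. AI-written, weaker than expert review; no statement of
[claim: Hironaka2017] is used. Setting as in `MonomialChartPresentationRange` (res-L1-w45a-stub-1 g2, p491807): `V` a unimodular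
exponent matrix (rows = the chart's rays), `E e = V·e`, `m` the chart's vertex of the monomial centre `I_A = (x^e : e ∈ A)`, `a i ∈ A` the
chart exponents with `E (a i) = E m + e_i`. There the ambient subscheme was a HYPERSURFACE `R̄ = k[X]/(f)`; here it is `R = k[X] ⧸ F` for an
ARBITRARY ideal `F` (complete intersections `F = (F₁, …, F_c)` are the CI-CN engine's case; nothing in this part depends on `F`).
For `u = x̄^m` the chart map is `Ψ_F : k[Y] → R[1/u]`, `Y_i ↦ x̄^{a i}/u`:
* `psi_monomial_mul_pow` — `Ψ_F(Y^c) · (u/1)^{|c|} = x̄^{Σ cᵢ • a i}/1`;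
* `psi_theta_X`, `psi_theta` — `Ψ_F ∘ θ` is the structure map `k[X] → R → R[1/u]` (`θ x^e = Y^{E e}`);
* `range_psi_eq_blowupAlgebra` — the RANGE of `Ψ_F` is the affine blow-up algebra `R[I_A R/u]`, i.e. the `x̄^m`-chart of the blow-up of
  `I_A·R` on `X = Spec R` (its strict transform under the toric modification when `X` is integral) is the image of `Ψ_F`.
The exponent identities of part §1 of `MonomialChartPresentationRange` are imported, not re-proved; the proofs of §2 are the g2 proofs with
`Ideal.span {f}` replaced by `F`. No definition is declared. [folklore: affine toric charts of monomial blow-ups, Cox–Little–Schenck §2.3/§10]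
-/

set_option linter.dupNamespace false

noncomputable section

open MvPolynomial

namespace Summit.ResolutionOfSingularities.ResolutionOfSingularities.Theorems.FInjectiveMacaulayfication.CIChartPresentationRange

open Summit.ResolutionOfSingularities.ResolutionOfSingularities.Theorems.FInjectiveMacaulayfication

variable {n : ℕ}

/-! ## The chart map `Ψ_F : Y_i ↦ x̄^{a i}/x̄^m` into `R[1/x̄^m]`, `R = k[X] ⧸ F`: values on monomials, `Ψ ∘ θ`, range -/

section Chart

variable {k : Type} [Field k] (F : Ideal (MvPolynomial (Fin n) k)) (V : Matrix (Fin n) (Fin n) ℕ)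
  (hV : IsUnit (V.map (Nat.cast : ℕ → ℤ)).det) (m : Fin n →₀ ℕ) (a : Fin n → (Fin n →₀ ℕ))
  (hgen : ∀ i : Fin n, (Finsupp.equivFunOnFinite.symm (V.mulVec ⇑(a i)) : Fin n →₀ ℕ) =
    Finsupp.equivFunOnFinite.symm (V.mulVec ⇑m) + Finsupp.single i 1)

/-- **`Ψ` on monomials**: `Ψ(Y^c) · (x̄^m/1)^{|c|} = x̄^{Σ_i c_i • a i}/1`. [folklore] -/
theorem psi_monomial_mul_pow (c : Fin n →₀ ℕ) :
    aeval (fun i : Fin n => algebraMap (MvPolynomial (Fin n) k ⧸ F)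
        (Localization.Away (Ideal.Quotient.mk F (monomial m (1 : k))))
        (Ideal.Quotient.mk F (monomial (a i) (1 : k))) *
      IsLocalization.Away.invSelf (Ideal.Quotient.mk F (monomial m (1 : k)))) (monomial c (1 : k)) *
      (algebraMap (MvPolynomial (Fin n) k ⧸ F)
        (Localization.Away (Ideal.Quotient.mk F (monomial m (1 : k))))
        (Ideal.Quotient.mk F (monomial m (1 : k)))) ^ (∑ i : Fin n, c i) =
      algebraMap (MvPolynomial (Fin n) k ⧸ F)
        (Localization.Away (Ideal.Quotient.mk F (monomial m (1 : k))))
        (Ideal.Quotient.mk F (monomial (∑ i : Fin n, c i • a i) (1 : k))) := by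
  set R := MvPolynomial (Fin n) k ⧸ F
  set u : R := Ideal.Quotient.mk F (monomial m (1 : k)) with hu
  set L := Localization.Away u
  rw [aeval_monomial, map_one, one_mul, Finsupp.prod_fintype _ _ (fun i => by simp)]
  simp_rw [mul_pow]
  rw [Finset.prod_mul_distrib, Finset.prod_pow_eq_pow_sum, mul_assoc, ← mul_pow, mul_comm (IsLocalization.Away.invSelf u),
    IsLocalization.Away.mul_invSelf, one_pow, mul_one]
  simp_rw [← map_pow]
  rw [← map_prod, ← map_prod, monomial_sum_index, C_1, one_mul]
  congr 2
  refine Finset.prod_congr rfl fun i _ => ?_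
  rw [monomial_pow, one_pow]

include hV hgen

/-- **(a) `Ψ (θ X_j) = x̄_j/1`**: the chart map composed with `θ` is the structure map `k[X] → R̄ → R̄[1/x̄^m]`, on variables. [folklore] -/
theorem psi_theta_X (j : Fin n) :
    aeval (fun i : Fin n => algebraMap (MvPolynomial (Fin n) k ⧸ F)
        (Localization.Away (Ideal.Quotient.mk F (monomial m (1 : k))))
        (Ideal.Quotient.mk F (monomial (a i) (1 : k))) *
      IsLocalization.Away.invSelf (Ideal.Quotient.mk F (monomial m (1 : k))))
      (∏ i : Fin n, (X i : MvPolynomial (Fin n) k) ^ V i j) =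
      algebraMap (MvPolynomial (Fin n) k ⧸ F)
        (Localization.Away (Ideal.Quotient.mk F (monomial m (1 : k))))
        (Ideal.Quotient.mk F (X j)) := by
  set R := MvPolynomial (Fin n) k ⧸ F
  set u : R := Ideal.Quotient.mk F (monomial m (1 : k)) with hu
  set L := Localization.Away u
  -- `∏ᵢ Yᵢ ^ V i j = monomial (col j) 1` with `col j = E e_j`
  have hcol : (∏ i : Fin n, (X i : MvPolynomial (Fin n) k) ^ V i j) =
      monomial (Finsupp.equivFunOnFinite.symm (V.mulVec ⇑(Finsupp.single j 1))) (1 : k) := by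
    rw [← ToricChartFedder.theta_monomial V (Finsupp.single j 1) (1 : k)]
    change _ = aeval _ (X j)
    rw [aeval_X]
  set c : Fin n →₀ ℕ := Finsupp.equivFunOnFinite.symm (V.mulVec ⇑(Finsupp.single j 1)) with hc_def
  have hc : ∀ i, c i = V i j := fun i => by
    rw [hc_def, ToricChartFedder.expMap_apply, Finset.sum_eq_single j]
    · rw [Finsupp.single_eq_same, mul_one]
    · intro j' _ hj'; rw [Finsupp.single_eq_of_ne hj', mul_zero]
    · intro h; exact absurd (Finset.mem_univ j) h
  have hU : IsUnit (algebraMap R L u ^ (∑ i : Fin n, c i)) := (IsLocalization.Away.algebraMap_isUnit u).pow _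
  rw [hcol]
  refine hU.mul_left_injective ?_
  simp only
  rw [psi_monomial_mul_pow F m a c]
  have hsum : ∑ i : Fin n, c i • a i = Finsupp.single j 1 + (∑ i : Fin n, c i) • m := by
    have h1 : ∑ i : Fin n, c i • a i = ∑ i : Fin n, V i j • a i := Finset.sum_congr rfl fun i _ => by rw [hc i]
    have h2 : ∑ i : Fin n, c i = ∑ i : Fin n, V i j := Finset.sum_congr rfl fun i _ => hc i
    rw [h1, h2]
    exact MonomialChartPresentationRange.sum_col_smul_a V hV m a hgen j
  have hmm : (monomial (Finsupp.single j 1 + (∑ i : Fin n, c i) • m) (1 : k) : MvPolynomial (Fin n) k) =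
      monomial (Finsupp.single j 1) 1 * (monomial m (1 : k)) ^ (∑ i : Fin n, c i) := by
    rw [monomial_pow, one_pow, monomial_mul, mul_one]
  rw [hsum, hmm, map_mul, map_mul, map_pow, map_pow]
  rfl

/-- **`Ψ ∘ θ` is the structure map**: `Ψ (θ q) = q̄/1` for every `q ∈ k[X]`. [folklore] -/
theorem psi_theta (q : MvPolynomial (Fin n) k) :
    aeval (fun i : Fin n => algebraMap (MvPolynomial (Fin n) k ⧸ F)
        (Localization.Away (Ideal.Quotient.mk F (monomial m (1 : k))))
        (Ideal.Quotient.mk F (monomial (a i) (1 : k))) *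
      IsLocalization.Away.invSelf (Ideal.Quotient.mk F (monomial m (1 : k))))
      (aeval (fun j : Fin n => ∏ i : Fin n, (X i : MvPolynomial (Fin n) k) ^ V i j) q) =
      algebraMap (MvPolynomial (Fin n) k ⧸ F)
        (Localization.Away (Ideal.Quotient.mk F (monomial m (1 : k))))
        (Ideal.Quotient.mk F q) := by
  set R := MvPolynomial (Fin n) k ⧸ F
  set u : R := Ideal.Quotient.mk F (monomial m (1 : k)) with hu
  set L := Localization.Away u
  set Ψ : MvPolynomial (Fin n) k →ₐ[k] L := aeval (fun i : Fin n => algebraMap R L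
    (Ideal.Quotient.mk F (monomial (a i) (1 : k))) * IsLocalization.Away.invSelf u) with hΨ
  set θ : MvPolynomial (Fin n) k →ₐ[k] MvPolynomial (Fin n) k :=
    aeval (fun j : Fin n => ∏ i : Fin n, (X i : MvPolynomial (Fin n) k) ^ V i j) with hθ
  have hcomp : Ψ.comp θ = (IsScalarTower.toAlgHom k R L).comp (Ideal.Quotient.mkₐ k F) := by
    refine MvPolynomial.algHom_ext fun j => ?_
    rw [AlgHom.comp_apply, AlgHom.comp_apply, hθ, aeval_X, hΨ, psi_theta_X F V hV m a hgen j,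
      Ideal.Quotient.mkₐ_eq_mk, IsScalarTower.coe_toAlgHom']
  have h := DFunLike.congr_fun hcomp q
  rw [AlgHom.comp_apply, AlgHom.comp_apply, Ideal.Quotient.mkₐ_eq_mk, IsScalarTower.coe_toAlgHom'] at h
  exact h

/-- **The range of `Ψ` is the affine blow-up algebra `R̄[I_A R̄ / x̄^m]`** (`I_A = (x^e : e ∈ A)`, `m ∈ A`, `a i ∈ A`, and the chart
inequalities `E m ≤ E e` for `e ∈ A`). [folklore] -/
theorem range_psi_eq_blowupAlgebra (A : Finset (Fin n →₀ ℕ)) (haA : ∀ i, a i ∈ A)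
    (hge : ∀ e ∈ A, (Finsupp.equivFunOnFinite.symm (V.mulVec ⇑m) : Fin n →₀ ℕ) ≤
      Finsupp.equivFunOnFinite.symm (V.mulVec ⇑e)) :
    Set.range (aeval (fun i : Fin n => algebraMap (MvPolynomial (Fin n) k ⧸ F)
        (Localization.Away (Ideal.Quotient.mk F (monomial m (1 : k))))
        (Ideal.Quotient.mk F (monomial (a i) (1 : k))) *
      IsLocalization.Away.invSelf (Ideal.Quotient.mk F (monomial m (1 : k)))) :
        MvPolynomial (Fin n) k → Localization.Away (Ideal.Quotient.mk F (monomial m (1 : k)))) =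
      (Literature.AlgebraicGeometry.Resolution.blowupAlgebra
        (Ideal.span ((fun e : Fin n →₀ ℕ => Ideal.Quotient.mk F (monomial e (1 : k))) '' (A : Set _)))
        (Ideal.Quotient.mk F (monomial m (1 : k))) : Set _) := by
  set R := MvPolynomial (Fin n) k ⧸ F
  set u : R := Ideal.Quotient.mk F (monomial m (1 : k)) with hu
  set L := Localization.Away u
  set Ψ : MvPolynomial (Fin n) k →ₐ[k] L := aeval (fun i : Fin n => algebraMap R L
    (Ideal.Quotient.mk F (monomial (a i) (1 : k))) * IsLocalization.Away.invSelf u) with hΨ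
  set I : Ideal R := Ideal.span ((fun e : Fin n →₀ ℕ => Ideal.Quotient.mk F (monomial e (1 : k))) ''
    (A : Set _)) with hI
  set B := Literature.AlgebraicGeometry.Resolution.blowupAlgebra I u with hB
  -- the range as an `R̄`-subalgebra (it contains `R̄` by `psi_theta`)
  have hRmem : ∀ r : R, algebraMap R L r ∈ Set.range Ψ := fun r => by
    obtain ⟨q, rfl⟩ := Ideal.Quotient.mk_surjective r
    exact ⟨_, psi_theta F V hV m a hgen q⟩
  let S : Subalgebra R L :=
    { carrier := Set.range Ψ
      mul_mem' := by
        rintro _ _ ⟨x, rfl⟩ ⟨y, rfl⟩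
        exact ⟨x * y, map_mul Ψ x y⟩
      add_mem' := by
        rintro _ _ ⟨x, rfl⟩ ⟨y, rfl⟩
        exact ⟨x + y, map_add Ψ x y⟩
      algebraMap_mem' := hRmem }
  apply le_antisymm
  · -- `range Ψ ⊆ B`: images of variables are generators, constants come from `R̄`
    rintro _ ⟨q, rfl⟩
    induction q using MvPolynomial.induction_on with
    | C c =>
      rw [hΨ, aeval_C, IsScalarTower.algebraMap_apply k R L]
      exact Subalgebra.algebraMap_mem B _
    | add p q hp hq => rw [map_add]; exact Subalgebra.add_mem B hp hq
    | mul_X p i hp =>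
      rw [map_mul, hΨ, aeval_X]
      refine Subalgebra.mul_mem B hp ?_
      exact Literature.AlgebraicGeometry.Resolution.div_mem_blowupAlgebra I u
        (Ideal.subset_span ⟨a i, haA i, rfl⟩)
  · -- `B ⊆ range Ψ`: `B = adjoin R̄ gens` and every generator `x/u`, `x ∈ I`, lies in the `R̄`-subalgebra `S`
    change (B : Set L) ⊆ (S : Set L)
    refine SetLike.coe_subset_coe.mpr (Algebra.adjoin_le ?_ : B ≤ S)
    rintro _ ⟨x, hx, rfl⟩
    -- induction over `x ∈ I = span (monomials of A)`
    refine Submodule.span_induction ?_ ?_ ?_ ?_ hx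
    · rintro _ ⟨e, he, rfl⟩
      obtain ⟨c, hc⟩ := MonomialChartPresentationRange.exists_repr_of_le V hV m a hgen e (hge e he)
      -- `x̄^e/u = Ψ(Y^c)`: from `Ψ(Y^c) u^{|c|} = x̄^{Σ cᵢaᵢ}/1` and `x^{Σ cᵢaᵢ} x^m = x^e (x^m)^{|c|}`
      set c' : Fin n →₀ ℕ := Finsupp.equivFunOnFinite.symm c with hc'
      have hcc : ∀ i, c' i = c i := fun i => by rw [hc', Finsupp.coe_equivFunOnFinite_symm]
      have h1 := psi_monomial_mul_pow F m a c'
      have hexp : ∑ i : Fin n, c' i • a i + m = e + (∑ i : Fin n, c' i) • m := by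
        simp_rw [hcc]; exact hc
      have hR : Ideal.Quotient.mk F (monomial (∑ i : Fin n, c' i • a i) (1 : k)) * u =
          Ideal.Quotient.mk F (monomial e (1 : k)) * u ^ (∑ i : Fin n, c' i) := by
        rw [hu, ← map_pow, ← map_mul, ← map_mul, monomial_pow, one_pow, monomial_mul, monomial_mul, mul_one, hexp]
      have h2 : algebraMap R L (Ideal.Quotient.mk F (monomial (∑ i : Fin n, c' i • a i) (1 : k))) *
          algebraMap R L u = algebraMap R L (Ideal.Quotient.mk F (monomial e (1 : k))) *
            algebraMap R L u ^ (∑ i : Fin n, c' i) := by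
        have h := congrArg (algebraMap R L) hR
        rwa [map_mul, map_mul, map_pow] at h
      have hU1 : IsUnit (algebraMap R L u) := IsLocalization.Away.algebraMap_isUnit u
      have hU : IsUnit (algebraMap R L u ^ (∑ i : Fin n, c' i)) := hU1.pow _
      refine ⟨monomial c' (1 : k), ?_⟩
      change Ψ (monomial c' 1) = algebraMap R L (Ideal.Quotient.mk F (monomial e (1 : k))) *
        IsLocalization.Away.invSelf u
      refine hU.mul_left_injective ?_
      simp only
      rw [hΨ, h1, mul_right_comm, ← h2, mul_assoc, IsLocalization.Away.mul_invSelf, mul_one]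
    · rw [map_zero, zero_mul]; exact Subalgebra.zero_mem S
    · intro x y _ _ hx hy
      rw [map_add, add_mul]; exact Subalgebra.add_mem S hx hy
    · intro r x _ hx
      rw [smul_eq_mul, map_mul, mul_assoc]
      exact Subalgebra.mul_mem S (Subalgebra.algebraMap_mem S r) hx

end Chart

end Summit.ResolutionOfSingularities.ResolutionOfSingularities.Theorems.FInjectiveMacaulayfication.CIChartPresentationRange

end
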